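import Summits.QuantumFields.YangMills.Theorems.BalabanUVNodesK0Stub3FinVolFaceOfActivitySlots

/-!
# K0⁷ V19 — STUB 3ᴬ′: THE SOCKET's WINDOW EDITION — `AbsBetaBoxAtThm1WitnessCCMGenAt F` ⟺ «for every admissible letter tuple SOME window witness `θ₁₅ᶜᶜᴹᵂ(j; γ₀)`, `0 < γ₀ ≤ ½`,
# whose β of record is boxed ON ITS OWN DESIGN WINDOW»; hence every θ-GENERIC box road may be delivered at a SMALL-window record and still pays V19's text and K0⁷ BY NAME

Cell `pub-ymgap`, width seat `pub-ymgap-k0-s3-w1` (g0-0, harness re-seat; director-ym R399 (3a) ∕ №207 «(j,c)-generic sub-faces of `stub_absBetaBoxAtThm1WitnessCCMGen13` by CLAIM»;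
bus CLAIM-1 + INTENT-1 I.32112).  `--kind proof --supports stmt-QuantumFields-20541 --as helper`, COUNT-NEUTRAL.  NEW leaf; theorems only — 0 `def`, 0 `sorry`; nothing modified;
no registry write.  Imports k0-s3-w2 g2's `…K0Stub3FinVolFaceOfActivitySlots` (p616231 ✓; through it `…K0Stub3FinVolFace` p613354, `…K0V19Stub2Prime` p595104, A2ʷ `Node00.Record13LettersOfThm1CCMW` and the N22 engines).
[I] = [Balaban1987RG1]; [II] = [Balaban1989LargeFieldII]; [III] = [Balaban1988Convergent]; [15] = [Balaban1985Variational]; [6] = [Balaban1985RegularSpaces].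

WHY (LOCATED; dag-n21-c g12's point — `…K0WindowOfStepTokensRCube` header — re-applied one level down, to the LETTERS that feed the box).  V19's registered text already lets the
box radius `γ₀` be the supplier's (`∃ γ₀ > 0`), and on `]0, γ₀]` the β of A1's collared witness `θ₁₅ᶜᶜᴹ(j)` (design window `½`) IS the β of the window witness `θ₁₅ᶜᶜᴹᵂ(j; γ₀)`
(design window `γ₀`): A2ʷ `betaOfRecord₁₃_theta13OfThm1CCMW_eq_of_mem` (`rfl`-level — same numerics `ν`, same `ε₂₉`, same chart, same merged term family; only `.γ` differs).  But the
θ-GENERIC box suppliers of the lane — the kernel-letter road (k0-s3-w1 g0 p610322 §2), the one-constant kernel-decay road (p608074 §3), the finite-volume ∕ fundamental-domain face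
(k0-s3-w2 g2 p613354 §4) and the ACTIVITY-SLOT face (k0-s3-w2 g2 p616231 §2b `absBox_betaOfRecord₁₃_of_activitySlots_of_approxStable`) — read their letters on the record's OWN window
`Window θ.γ` ∕ `Box θ.γ`, and the N22 record-level engines behind the last one (`uniformEventualDecayOnBox_of_activitySlotsAtRecord`, `polLimitsExistOfRecord₁₃_of_activitySlots`) are
keyed on `Window θ.γ` as well.  Applied at `θ₁₅ᶜᶜᴹ(j)` that is `Window ½`: the (2.38) value slot `Bound238 (Wk K k)` under `A·e^{5r₁+1}·K₀(64,8)·9·64 ≤ 1`, the activity holomorphy and the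
(S≈) stability would be demanded for ALL histories with couplings up to `g = 0.5` — K0a's DISPLAY default, not print's «γ sufficiently small» ([I] Thm 1 p.255, §1 p.264; [II] (1.4) p.357).
Applied at `θ₁₅ᶜᶜᴹᵂ(j; γ₀)` it is `Window γ₀` for a `γ₀` of the supplier's choosing — print's regime.  §1 makes this keying available BY NAME for every road at once; §2 instantiates it on the
activity-slot face.

CONTENTS (kernel-checked; CONDITIONAL — every letter DISPLAYED, inhabited nowhere).
§1 (generic; over `K0V19Defs` + A2ʷ): `abs3A'_of_windowBoxAt` (box radius spelled `γ₀`) · ★ `abs3A'_of_ownWindowBoxAt` (box radius spelled `θᵂ.γ` — what a θ-generic supplier returns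
   verbatim) · ★ `ownWindowBoxAt_of_abs3A'` (converse, at `γ₁ = min γ₀ ½`) · ★★ `abs3A'_iff_ownWindowBoxAt` · ★★ `abs3A'_of_genericRoadAtWindowWitness` (ROAD SCHEMA: any predicate `P θ` with
   `P θ → 0 < θ.γ → ∃ β′, box of β₁₃(θ) on ]0, θ.γ]`, inhabited at SOME window witness with `γ₀ ≤ ½` per admissible tuple, pays 3ᴬ′) · ★★ `record13SepCoPHInhabited_of_stub1_ownWindowBoxAt_byName`,
   ★★ `record13SepCoPHInhabited_of_stub1_genericRoadAtWindowWitness_byName` (K0⁷ BY NAME with stub 1's text; stub 2′ by name, p595104).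
§2 (instance, point-level, by name over p616231): ★★★ `absBoxAt_of_activitySlotsAtWindowWitness` — k0-s3-w2 g2's `absBox_betaOfRecord₁₃_of_activitySlots_of_approxStable` run AT THE WINDOW
   WITNESS `θW = θ₁₅ᶜᶜᴹᵂ(j; γ₀, …)` (its forty binders VERBATIM with `θ := θW`, `N := 2`; the letters therefore read `Window γ₀`), `γ₀ ≤ ½` ⟹ the `γ₀`-box of A1's witness `θ₁₅ᶜᶜᴹ(j)` —
   the shape V19's text asks per tuple; ★★★ `abs3A'_of_activitySlotsAtWindowWitnesses` (socket level: such data for SOME `γ₀ ≤ ½`, `ε₀, ε₂₉ > 0` per admissible tuple ⟹ 3ᴬ′(F)) is left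
   to the supplier as the one-line `abs3A'_of_windowBoxAt F (fun … => ⟨γ₀, ε₀, ε₂₉, β′, …, §2⟩)` (no Type-valued data can be packed under a per-tuple `∃` without choosing universes for it).

HONEST FRAMING (binding).  By-name composition + A2ʷ's `rfl`-level β transfer + `min`; NO β estimate; nothing of Bałaban's analysis asserted or proved; stub 3ᴬ′ NOT proved; K0⁷
stmt-QuantumFields-20541 OPEN (V19 87879403b3a26109 STANDS); counts unmoved (typed 28∕28 · discharged 5∕27 — the chair's words); no summit statement is proved by this seat; route R4 closes the
CONDITIONAL finite-𝕋⁴ rung `BalabanLadder.UV` only — NOTHING about the continuum limit, ℝ⁴, OS axioms, a mass gap or the Clay problem is proved or claimed.  No `sorry`, `def`, `instance`,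
`notation`, `axiom`; standard axioms.
-/

noncomputable section

open Filter Topology Metric Set
open scoped BigOperators Matrix.Norms.L2Operator

namespace Summit.QuantumFields.YangMills.Theorems.K0Stub3SocketWindowEdition

open Literature.MathematicalPhysics.QuantumFieldTheory.Balaban1983to89
open Literature.MathematicalPhysics.QuantumFieldTheory.Balaban1983to89.Node00
open Literature.MathematicalPhysics.QuantumFieldTheory.Balaban1983to89.T4Continuum
open Literature.MathematicalPhysics.QuantumFieldTheory.Balaban1983to89.FlowStep
open Summit.QuantumFields.YangMills.Theorems.K0V19Defs (Prop8StepCoPAt AbsBetaBoxAtThm1WitnessCCMGenAt)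
open Summit.QuantumFields.YangMills.Theorems.K0V19Stub2Prime (record13SepCoPHInhabited_of_stub1_stub3A'_byName)
open Literature.MathematicalPhysics.QuantumFieldTheory.Balaban1983to89.T4OutputRate (Window)
open Literature.MathematicalPhysics.QuantumFieldTheory.Balaban1983to89.Node00.Sect2 (domCount domSys CPair)
open Literature.MathematicalPhysics.QuantumFieldTheory.Balaban1983to89.Node00.LocalizedSum17 (ReadingMaps Localizes17OfRecord₁₃)
open Literature.MathematicalPhysics.QuantumFieldTheory.Balaban1983to89.Node00.W1 (ClusterTower)
open Literature.MathematicalPhysics.QuantumFieldTheory.Balaban1983to89.Node00.U3OfKernels (histPrefix)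
open Literature.MathematicalPhysics.QuantumFieldTheory.Balaban1983to89.B12Decay510 (delta1)
open Literature.MathematicalPhysics.QuantumFieldTheory.Balaban1983to89.B12Decay510Window (K₁)
open Literature.MathematicalPhysics.QuantumFieldTheory.Balaban1983to89.B12Decay510Torus (distCT nearT)
open Literature.MathematicalPhysics.QuantumFieldTheory.Balaban1983to89.B12TreeDecay (K₀ kappa₀)
open Literature.MathematicalPhysics.QuantumFieldTheory.Balaban1983to89.TreeLengthTorus (TPt torusTreeLen)
open Literature.MathematicalPhysics.QuantumFieldTheory.Balaban1983to89.B12Sec2to5 (betaPrime510)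
open Summit.QuantumFields.YangMills.Theorems.K0Stub3FinVolFaceOfActivitySlots (absBox_betaOfRecord₁₃_of_activitySlots_of_approxStable)

/-! ## §1  The socket's window edition, generic -/

section Generic

variable (F : T4Family)

/-- **V19's SOCKET FROM `γ₀`-BOXES OF THE WINDOW WITNESSES** (`0 < γ₀ ≤ ½`, box radius spelled `γ₀`): for every cube letter and constants where the guards and the tokens (8)∕(9) hold,
SOME `γ₀ ∈ ]0, ½]`, thresholds `ε₀, ε₂₉ > 0` and `β′` with `−β′ ≤ β₁₃(θ₁₅ᶜᶜᴹᵂ(j; γ₀, ε₀, ε₂₉; B₃, B₃′, a₀, a₁)) ≤ β′` on `]0, γ₀]^{k+1}` ⟹ `K0V19Defs.AbsBetaBoxAtThm1WitnessCCMGenAt F`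
(A2ʷ `betaLowerH_half_of_theta13OfThm1CCMW` ∕ `betaUpperH_half_…`: on `]0, γ₀]` the two witnesses have the SAME β).  The step g0 inlined in p611287 §4, now by name.  CONDITIONAL on the boxes.
[cite: Balaban1987RG1, Thm 1 p.255, (1.20)–(1.22) p.264, §1 p.264; Balaban1985Variational, Thm 1 (8)–(9) p.279; Balaban1988Convergent, Thm 1 p.262] -/
theorem abs3A'_of_windowBoxAt
    (h : ∀ (j c : ℕ) (B₃ B₃' a₀ a₁ : ℝ), c ≤ F.L ^ j → 2 * (F.L : ℝ) ^ 2 ≤ B₃ → 0 < B₃' → 0 < a₀ → 0 < a₁ →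
      VariationalThm1RegSepCoP7M F 2 B₃ a₀ a₁ →
      Gauge9RegSepTopStepR F 2 (fun ν K Ω => suppDomOfRecord F ν K Ω) (F.L ^ j) c B₃ B₃' a₀ a₁ →
      ∃ γ₀ ε₀ ε₂₉ β' : ℝ, 0 < γ₀ ∧ γ₀ ≤ 1 / 2 ∧ 0 < ε₀ ∧ 0 < ε₂₉ ∧
        BetaLowerH (-β') γ₀ (betaOfRecord₁₃ F 2 (theta13OfThm1CCMW F 2 j γ₀ ε₀ ε₂₉ B₃ B₃' a₀ a₁)) ∧
        BetaUpperH β' γ₀ (betaOfRecord₁₃ F 2 (theta13OfThm1CCMW F 2 j γ₀ ε₀ ε₂₉ B₃ B₃' a₀ a₁))) :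
    AbsBetaBoxAtThm1WitnessCCMGenAt F := by
  intro j c B₃ B₃' a₀ a₁ hc hB hB' ha₀ ha₁ h15 h9
  obtain ⟨γ₀, ε₀, ε₂₉, β', hγ₀, hγh, hε, hε', hlow, hup⟩ := h j c B₃ B₃' a₀ a₁ hc hB hB' ha₀ ha₁ h15 h9
  exact ⟨γ₀, ε₀, ε₂₉, β', hγ₀, hε, hε', betaLowerH_half_of_theta13OfThm1CCMW hγh hlow, betaUpperH_half_of_theta13OfThm1CCMW hγh hup⟩

/-- **★ V19's SOCKET FROM OWN-WINDOW BOXES OF THE WINDOW WITNESSES** (box radius spelled `θᵂ.γ` — VERBATIM what a θ-GENERIC box road `∀ θ, letters θ → ∃ β′, BetaLowerH (−β′) θ.γ β₁₃(θ) ∧ …`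
returns when run at `θ := θ₁₅ᶜᶜᴹᵂ(j; γ₀, …)`): such boxes for SOME `γ₀ ∈ ]0, ½]`, `ε₀, ε₂₉ > 0` per admissible tuple ⟹ `K0V19Defs.AbsBetaBoxAtThm1WitnessCCMGenAt F` (`θᵂ.γ = γ₀` by
A2ʷ `theta13OfThm1CCMW_γ`, then `abs3A'_of_windowBoxAt`).  CONDITIONAL on the boxes; stub 3ᴬ′ NOT proved. [cite: Balaban1987RG1, Thm 1 p.255, (1.20)–(1.22) p.264, §1 p.264; Balaban1989LargeFieldII, (1.4) p.357] -/
theorem abs3A'_of_ownWindowBoxAt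
    (h : ∀ (j c : ℕ) (B₃ B₃' a₀ a₁ : ℝ), c ≤ F.L ^ j → 2 * (F.L : ℝ) ^ 2 ≤ B₃ → 0 < B₃' → 0 < a₀ → 0 < a₁ →
      VariationalThm1RegSepCoP7M F 2 B₃ a₀ a₁ →
      Gauge9RegSepTopStepR F 2 (fun ν K Ω => suppDomOfRecord F ν K Ω) (F.L ^ j) c B₃ B₃' a₀ a₁ →
      ∃ γ₀ ε₀ ε₂₉ β' : ℝ, 0 < γ₀ ∧ γ₀ ≤ 1 / 2 ∧ 0 < ε₀ ∧ 0 < ε₂₉ ∧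
        BetaLowerH (-β') (theta13OfThm1CCMW F 2 j γ₀ ε₀ ε₂₉ B₃ B₃' a₀ a₁).γ (betaOfRecord₁₃ F 2 (theta13OfThm1CCMW F 2 j γ₀ ε₀ ε₂₉ B₃ B₃' a₀ a₁)) ∧
        BetaUpperH β' (theta13OfThm1CCMW F 2 j γ₀ ε₀ ε₂₉ B₃ B₃' a₀ a₁).γ (betaOfRecord₁₃ F 2 (theta13OfThm1CCMW F 2 j γ₀ ε₀ ε₂₉ B₃ B₃' a₀ a₁))) :
    AbsBetaBoxAtThm1WitnessCCMGenAt F := by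
  refine abs3A'_of_windowBoxAt F fun j c B₃ B₃' a₀ a₁ hc hB hB' ha₀ ha₁ h15 h9 => ?_
  obtain ⟨γ₀, ε₀, ε₂₉, β', hγ₀, hγh, hε, hε', hlow, hup⟩ := h j c B₃ B₃' a₀ a₁ hc hB hB' ha₀ ha₁ h15 h9
  rw [theta13OfThm1CCMW_γ] at hlow hup
  exact ⟨γ₀, ε₀, ε₂₉, β', hγ₀, hγh, hε, hε', hlow, hup⟩

/-- **★ CONVERSELY: V19's SOCKET GIVES OWN-WINDOW BOXES OF WINDOW WITNESSES** — at `γ₁ := min γ₀ ½` for the text's `γ₀`: restrict the box of A1's witness to `]0, γ₁]`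
(A2ʷ `betaBox_restrict_of_le`) and transfer it to `θ₁₅ᶜᶜᴹᵂ(j; γ₁)` (A2ʷ `betaLowerH_theta13OfThm1CCMW_of_half` ∕ `betaUpperH_…`).  So NO content is lost by the window keying.
[cite: Balaban1987RG1, (1.20)–(1.22) p.264, §1 p.264 (bookkeeping)] -/
theorem ownWindowBoxAt_of_abs3A' (h : AbsBetaBoxAtThm1WitnessCCMGenAt F) :
    ∀ (j c : ℕ) (B₃ B₃' a₀ a₁ : ℝ), c ≤ F.L ^ j → 2 * (F.L : ℝ) ^ 2 ≤ B₃ → 0 < B₃' → 0 < a₀ → 0 < a₁ →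
      VariationalThm1RegSepCoP7M F 2 B₃ a₀ a₁ →
      Gauge9RegSepTopStepR F 2 (fun ν K Ω => suppDomOfRecord F ν K Ω) (F.L ^ j) c B₃ B₃' a₀ a₁ →
      ∃ γ₀ ε₀ ε₂₉ β' : ℝ, 0 < γ₀ ∧ γ₀ ≤ 1 / 2 ∧ 0 < ε₀ ∧ 0 < ε₂₉ ∧
        BetaLowerH (-β') (theta13OfThm1CCMW F 2 j γ₀ ε₀ ε₂₉ B₃ B₃' a₀ a₁).γ (betaOfRecord₁₃ F 2 (theta13OfThm1CCMW F 2 j γ₀ ε₀ ε₂₉ B₃ B₃' a₀ a₁)) ∧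
        BetaUpperH β' (theta13OfThm1CCMW F 2 j γ₀ ε₀ ε₂₉ B₃ B₃' a₀ a₁).γ (betaOfRecord₁₃ F 2 (theta13OfThm1CCMW F 2 j γ₀ ε₀ ε₂₉ B₃ B₃' a₀ a₁)) := by
  intro j c B₃ B₃' a₀ a₁ hc hB hB' ha₀ ha₁ h15 h9
  obtain ⟨γ₀, ε₀, ε₂₉, β', hγ₀, hε, hε', hlow, hup⟩ := h j c B₃ B₃' a₀ a₁ hc hB hB' ha₀ ha₁ h15 h9
  have hγ₁ : 0 < min γ₀ (1 / 2) := lt_min hγ₀ (by norm_num)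
  have hγ₁h : min γ₀ (1 / 2) ≤ 1 / 2 := min_le_right _ _
  obtain ⟨hlow₁, hup₁⟩ := betaBox_restrict_of_le (min_le_left γ₀ (1 / 2)) hlow hup
  refine ⟨min γ₀ (1 / 2), ε₀, ε₂₉, β', hγ₁, hγ₁h, hε, hε', ?_, ?_⟩
  · rw [theta13OfThm1CCMW_γ]; exact betaLowerH_theta13OfThm1CCMW_of_half hγ₁h hlow₁
  · rw [theta13OfThm1CCMW_γ]; exact betaUpperH_theta13OfThm1CCMW_of_half hγ₁h hup₁

/-- **★★ THE WINDOW EDITION IS AN EQUIVALENT FORM OF V19's REGISTERED TEXT**: `K0V19Defs.AbsBetaBoxAtThm1WitnessCCMGenAt F` ⟺ own-window boxes at SOME window witness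
`θ₁₅ᶜᶜᴹᵂ(j; γ₀)`, `0 < γ₀ ≤ ½`, per admissible tuple.  A supplier may therefore work ENTIRELY at a small-window record.  (An iff repackaging of the registered text; the text is unchanged,
V19 STANDS, no re-registration.) [cite: Balaban1987RG1, Thm 1 p.255, (1.20)–(1.22) p.264, §1 p.264; Balaban1989LargeFieldII, (1.4) p.357] -/
theorem abs3A'_iff_ownWindowBoxAt :
    AbsBetaBoxAtThm1WitnessCCMGenAt F ↔
      ∀ (j c : ℕ) (B₃ B₃' a₀ a₁ : ℝ), c ≤ F.L ^ j → 2 * (F.L : ℝ) ^ 2 ≤ B₃ → 0 < B₃' → 0 < a₀ → 0 < a₁ →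
        VariationalThm1RegSepCoP7M F 2 B₃ a₀ a₁ →
        Gauge9RegSepTopStepR F 2 (fun ν K Ω => suppDomOfRecord F ν K Ω) (F.L ^ j) c B₃ B₃' a₀ a₁ →
        ∃ γ₀ ε₀ ε₂₉ β' : ℝ, 0 < γ₀ ∧ γ₀ ≤ 1 / 2 ∧ 0 < ε₀ ∧ 0 < ε₂₉ ∧
          BetaLowerH (-β') (theta13OfThm1CCMW F 2 j γ₀ ε₀ ε₂₉ B₃ B₃' a₀ a₁).γ (betaOfRecord₁₃ F 2 (theta13OfThm1CCMW F 2 j γ₀ ε₀ ε₂₉ B₃ B₃' a₀ a₁)) ∧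
          BetaUpperH β' (theta13OfThm1CCMW F 2 j γ₀ ε₀ ε₂₉ B₃ B₃' a₀ a₁).γ (betaOfRecord₁₃ F 2 (theta13OfThm1CCMW F 2 j γ₀ ε₀ ε₂₉ B₃ B₃' a₀ a₁)) :=
  ⟨ownWindowBoxAt_of_abs3A' F, abs3A'_of_ownWindowBoxAt F⟩

/-- **★★ THE ROAD SCHEMA — EVERY θ-GENERIC BOX ROAD PAYS THE SOCKET FROM A SMALL-WINDOW RECORD.**  Let `P θ` be any package of letters on Stage-13 parameters (kernel letters, W1's
finite-volume letters, the one-constant decay, the fundamental-domain face, N22's activity-slot letters, …) for which the lane holds a θ-generic road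
`P θ → 0 < θ.γ → ∃ β′, BetaLowerH (−β′) θ.γ β₁₃(θ) ∧ BetaUpperH β′ θ.γ β₁₃(θ)`.  If for every admissible tuple `P` is inhabited at SOME window witness `θ₁₅ᶜᶜᴹᵂ(j; γ₀, ε₀, ε₂₉; …)` with
`0 < γ₀ ≤ ½`, `ε₀, ε₂₉ > 0` — i.e. with its letters read on `Window γ₀`, NOT on `Window ½` — then `K0V19Defs.AbsBetaBoxAtThm1WitnessCCMGenAt F`.  CONDITIONAL on the road and on `P`
(displayed); nothing of Bałaban asserted. [cite: Balaban1987RG1, Thm 1 p.255, §1 p.264, (5.10) p.293; Balaban1989LargeFieldII, (1.4) p.357; Balaban1988Convergent, Thm 1 p.262] -/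
theorem abs3A'_of_genericRoadAtWindowWitness (P : Stage13Params F 2 → Prop)
    (hroad : ∀ θ : Stage13Params F 2, P θ → 0 < θ.γ → ∃ β' : ℝ, BetaLowerH (-β') θ.γ (betaOfRecord₁₃ F 2 θ) ∧ BetaUpperH β' θ.γ (betaOfRecord₁₃ F 2 θ))
    (hAt : ∀ (j c : ℕ) (B₃ B₃' a₀ a₁ : ℝ), c ≤ F.L ^ j → 2 * (F.L : ℝ) ^ 2 ≤ B₃ → 0 < B₃' → 0 < a₀ → 0 < a₁ →
      VariationalThm1RegSepCoP7M F 2 B₃ a₀ a₁ →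
      Gauge9RegSepTopStepR F 2 (fun ν K Ω => suppDomOfRecord F ν K Ω) (F.L ^ j) c B₃ B₃' a₀ a₁ →
      ∃ γ₀ ε₀ ε₂₉ : ℝ, 0 < γ₀ ∧ γ₀ ≤ 1 / 2 ∧ 0 < ε₀ ∧ 0 < ε₂₉ ∧ P (theta13OfThm1CCMW F 2 j γ₀ ε₀ ε₂₉ B₃ B₃' a₀ a₁)) :
    AbsBetaBoxAtThm1WitnessCCMGenAt F := by
  refine abs3A'_of_ownWindowBoxAt F fun j c B₃ B₃' a₀ a₁ hc hB hB' ha₀ ha₁ h15 h9 => ?_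
  obtain ⟨γ₀, ε₀, ε₂₉, hγ₀, hγh, hε, hε', hP⟩ := hAt j c B₃ B₃' a₀ a₁ hc hB hB' ha₀ ha₁ h15 h9
  have hγ : 0 < (theta13OfThm1CCMW F 2 j γ₀ ε₀ ε₂₉ B₃ B₃' a₀ a₁).γ := by rw [theta13OfThm1CCMW_γ]; exact hγ₀
  obtain ⟨β', hlow, hup⟩ := hroad _ hP hγ
  exact ⟨γ₀, ε₀, ε₂₉, β', hγ₀, hγh, hε, hε', hlow, hup⟩

/-- **★★ K0⁷ BY NAME FROM STUB 1's TEXT AND OWN-WINDOW BOXES OF WINDOW WITNESSES** (stub 2′ by name inside `K0V19Stub2Prime.record13SepCoPHInhabited_of_stub1_stub3A'_byName`, p595104).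
CONDITIONAL on `h1` (stub 1's registered text, NOT proved here) and the boxes; K0⁷ OPEN; a helper, not a closer. [cite: Balaban1985Variational, Thm 1 (8)–(9) p.279, Prop. 8 p.304; Balaban1985RegularSpaces, Prop. 6 p.99; Balaban1988Convergent, Thm 1 p.262; Balaban1987RG1, Thm 1 p.255, §1 p.264] -/
theorem record13SepCoPHInhabited_of_stub1_ownWindowBoxAt_byName (h1 : ∀ F : T4Family, Prop8StepCoPAt F)
    (h : ∀ (F : T4Family) (j c : ℕ) (B₃ B₃' a₀ a₁ : ℝ), c ≤ F.L ^ j → 2 * (F.L : ℝ) ^ 2 ≤ B₃ → 0 < B₃' → 0 < a₀ → 0 < a₁ →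
      VariationalThm1RegSepCoP7M F 2 B₃ a₀ a₁ →
      Gauge9RegSepTopStepR F 2 (fun ν K Ω => suppDomOfRecord F ν K Ω) (F.L ^ j) c B₃ B₃' a₀ a₁ →
      ∃ γ₀ ε₀ ε₂₉ β' : ℝ, 0 < γ₀ ∧ γ₀ ≤ 1 / 2 ∧ 0 < ε₀ ∧ 0 < ε₂₉ ∧
        BetaLowerH (-β') (theta13OfThm1CCMW F 2 j γ₀ ε₀ ε₂₉ B₃ B₃' a₀ a₁).γ (betaOfRecord₁₃ F 2 (theta13OfThm1CCMW F 2 j γ₀ ε₀ ε₂₉ B₃ B₃' a₀ a₁)) ∧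
        BetaUpperH β' (theta13OfThm1CCMW F 2 j γ₀ ε₀ ε₂₉ B₃ B₃' a₀ a₁).γ (betaOfRecord₁₃ F 2 (theta13OfThm1CCMW F 2 j γ₀ ε₀ ε₂₉ B₃ B₃' a₀ a₁))) :
    Summit.QuantumFields.YangMills.Theses.BalabanUVNodes.Record13SepCoPHInhabited :=
  record13SepCoPHInhabited_of_stub1_stub3A'_byName h1 fun F => abs3A'_of_ownWindowBoxAt F (h F)

/-- **★★ K0⁷ BY NAME FROM STUB 1's TEXT AND ANY θ-GENERIC BOX ROAD INHABITED AT SMALL-WINDOW WITNESSES** (the road schema per family; stub 2′ by name, p595104).  CONDITIONAL on `h1`,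
the roads and their letter packages `P F`; K0⁷ OPEN; a helper, not a closer. [cite: Balaban1985Variational, Thm 1 (8)–(9) p.279, Prop. 8 p.304; Balaban1985RegularSpaces, Prop. 6 p.99; Balaban1988Convergent, Thm 1 p.262; Balaban1987RG1, Thm 1 p.255, §1 p.264, (5.10) p.293] -/
theorem record13SepCoPHInhabited_of_stub1_genericRoadAtWindowWitness_byName (h1 : ∀ F : T4Family, Prop8StepCoPAt F)
    (P : (F : T4Family) → Stage13Params F 2 → Prop)
    (hroad : ∀ (F : T4Family) (θ : Stage13Params F 2), P F θ → 0 < θ.γ →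
      ∃ β' : ℝ, BetaLowerH (-β') θ.γ (betaOfRecord₁₃ F 2 θ) ∧ BetaUpperH β' θ.γ (betaOfRecord₁₃ F 2 θ))
    (hAt : ∀ (F : T4Family) (j c : ℕ) (B₃ B₃' a₀ a₁ : ℝ), c ≤ F.L ^ j → 2 * (F.L : ℝ) ^ 2 ≤ B₃ → 0 < B₃' → 0 < a₀ → 0 < a₁ →
      VariationalThm1RegSepCoP7M F 2 B₃ a₀ a₁ →
      Gauge9RegSepTopStepR F 2 (fun ν K Ω => suppDomOfRecord F ν K Ω) (F.L ^ j) c B₃ B₃' a₀ a₁ →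
      ∃ γ₀ ε₀ ε₂₉ : ℝ, 0 < γ₀ ∧ γ₀ ≤ 1 / 2 ∧ 0 < ε₀ ∧ 0 < ε₂₉ ∧ P F (theta13OfThm1CCMW F 2 j γ₀ ε₀ ε₂₉ B₃ B₃' a₀ a₁)) :
    Summit.QuantumFields.YangMills.Theses.BalabanUVNodes.Record13SepCoPHInhabited :=
  record13SepCoPHInhabited_of_stub1_stub3A'_byName h1 fun F => abs3A'_of_genericRoadAtWindowWitness F (P F) (hroad F) (hAt F)

end Generic

/-! ## §2  Instance (point level, by name over p616231): N22's activity-slot letters AT THE WINDOW WITNESS `θ₁₅ᶜᶜᴹᵂ(j; γ₀)` ⟹ the `γ₀`-box of A1's witness -/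

section ActivitySlotsAtWindowWitness

variable (F : T4Family)

open Classical in
/-- **★★★ THE ACTIVITY-SLOT FACE AT A SMALL-WINDOW RECORD PAYS THE `γ₀`-BOX V19's TEXT ASKS.**  `θW` is the window witness `θ₁₅ᶜᶜᴹᵂ(j; γ₀, ε₀, ε₂₉; B₃, B₃′, a₀, a₁)` (pass `hθ := rfl`),
`0 < γ₀ ≤ ½`; the remaining binders are k0-s3-w2 g2's `absBox_betaOfRecord₁₃_of_activitySlots_of_approxStable` VERBATIM with `θ := θW`, `N := 2` (the tail constant renamed `Bt`):
towers `S` of cube side `M = L^{m′}`, reading maps `emb` with the (1.7) law `Localizes17OfRecord₁₃ F 2 θW S emb`, prefix sets `Wk ∋` the cut histories of `Window θW.γ = Window γ₀`, the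
(2.38) value slot `Bound238` with Road 1's numerals, complexified readings `ι ∕ Φ` on open `U ⊇ ball 0 r` with activity holomorphy on `Wk`, site weights with the p. 282 tails, the locality cut
`lo ∕ hlo`, and the (S≈) approximate cross-volume stability `hS` on `Window γ₀` — so EVERY letter is read for couplings in `]0, γ₀]` only.  Conclusion: `∃ β′, −β′ ≤ β₁₃(θ₁₅ᶜᶜᴹ(j; ε₀, ε₂₉; …)) ≤ β′`
on `]0, γ₀]^{k+1}` for all `k` (g2's box at `θW` on its own window, then A2ʷ's transfer; `β′ = β′₅₁₀(4; C_unif, δ₁)` as there).  Socket level: feed `abs3A'_of_windowBoxAt` per admissible tuple.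
CONDITIONAL on the activity-level letters + laws (NODE A ∕ N10 ∕ def-W1 owners; displayed, inhabited nowhere); NO estimate of Bałaban's proved or asserted; stub 3ᴬ′ NOT proved; K0⁷ OPEN.
[cite: Balaban1987RG1, Thm 1 p.255, (1.7) p.261, (1.18) p.263, (1.20)–(1.22) p.264, §1 p.264, p.282, (5.10) p.293; Balaban1988RG2Cluster, (2.13)–(2.14) pp.14–15, Lemma 3 (2.38) p.20; Balaban1989LargeFieldII, (1.4) p.357] -/
theorem absBoxAt_of_activitySlotsAtWindowWitness {j : ℕ} {γ₀ ε₀ ε₂₉ B₃ B₃' a₀ a₁ : ℝ} (hγh : γ₀ ≤ 1 / 2)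
    (θW : Stage13Params F 2) (hθ : θW = theta13OfThm1CCMW F 2 j γ₀ ε₀ ε₂₉ B₃ B₃' a₀ a₁)
    (m' : ℕ) (M : ℕ) [NeZero M] (hM : M = F.L ^ m')
    (S : (K : ℕ) → ClusterTower (F.P K) (MatA 2) M) (emb : ReadingMaps F (MatA 2) (MatA 2)) (hloc : Localizes17OfRecord₁₃ F 2 θW S emb)
    (Wk : (K k : ℕ) → Set (Fin (k + 1) → ℝ)) (hWk : ∀ g ∈ Window θW.γ, ∀ K k, histPrefix g k ∈ Wk K k)
    (sp : (K k : ℕ) → (domSys (F.P K) M (k + 1)).Dom → Set (CPair (F.P K) (MatA 2)))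
    {A R r₁ κ δ₀ Bt r r₀ : ℝ} (hκpos : 0 < κ)
    (hA : 0 ≤ A) (hr₁ : 0 ≤ r₁) (hκ : κ ≤ r₁) (hκ4 : kappa₀ (4 * 2 ^ 4) (2 * 4) ≤ κ / 2 / 2) (hrate : r₁ + 2 * (64 * Real.log 162) + 2 ≤ R)
    (hsmall : A * Real.exp (5 * r₁ + 1) * K₀ 64 8 * 9 * 64 ≤ 1) (hδ₀ : 0 < δ₀) (hBt : 0 ≤ Bt) (hr : 0 < r)
    (h238 : ∀ K k, ((S K) k).Bound238 (Wk K k) (sp K k) A R)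
    (Ec : ℕ → ℕ → Type*) [∀ K k, NormedAddCommGroup (Ec K k)] [∀ K k, NormedSpace ℂ (Ec K k)]
    (ι : letI := θW.instVβ₁; letI := θW.instVβ₂
      (K k : ℕ) → (domSys (F.P K) M (k + 1)).Dom → ((Fin (F.P K).d → Site (F.P K) (k + 1) → θW.Vβ) →L[ℝ] Ec K k))
    (Φ : (K k : ℕ) → (domSys (F.P K) M (k + 1)).Dom → Ec K k → CPair (F.P K) (MatA 2))
    (U : (K k : ℕ) → (domSys (F.P K) M (k + 1)).Dom → Set (Ec K k)) (hU : ∀ K k X, IsOpen (U K k X)) (hrU : ∀ K k X, ball (0 : Ec K k) r ⊆ U K k X)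
    (hHhol : ∀ K k, ∀ hist ∈ Wk K k, ∀ (X Z : (domSys (F.P K) M (k + 1)).Dom), Z.1 ⊆ X.1 →
      DifferentiableOn ℂ (fun z => ((S K) k).H hist (Φ K k X z) Z) (U K k X))
    (hΦemb : letI := θW.instVβ₁; letI := θW.instVβ₂
      ∀ (K k : ℕ) (X : (domSys (F.P K) M (k + 1)).Dom) (B : Fin (F.P K).d → Site (F.P K) (k + 1) → θW.Vβ),
        Φ K k X (ι K k X B) = emb K k (fun l t => NormedSpace.exp (θW.ρ8 (B l t))))
    (hΦsp : ∀ (K k : ℕ) (X : (domSys (F.P K) M (k + 1)).Dom), ∀ z ∈ U K k X, ∀ Z : (domSys (F.P K) M (k + 1)).Dom, Z.1 ⊆ X.1 → Φ K k X z ∈ sp K k Z)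
    (w : (K k : ℕ) → (domSys (F.P K) M (k + 1)).Dom → Site (F.P K) (k + 1) → ℝ) (hw₀ : ∀ K k X t, 0 ≤ w K k X t)
    (hw : letI := θW.instVβ₁; letI := θW.instVβ₂; letI := θW.instιβ
      ∀ (K k : ℕ) (X : (domSys (F.P K) M (k + 1)).Dom) (l : Fin (F.P K).d) (t : Site (F.P K) (k + 1)) (c : θW.ιβ),
        ‖ι K k X (Pi.single l (Pi.single t (θW.bV c)))‖ ≤ w K k X t)
    (htail : ∀ (K k : ℕ) (X : (domSys (F.P K) M (k + 1)).Dom) (t : Site (F.P K) (k + 1)),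
      let e : Site (F.P K) (k + 1) → TPt 4 (domCount (F.P K) M (k + 1) * M) := fun x i => (ZMod.cast (x i) : ZMod (domCount (F.P K) M (k + 1) * M))
      w K k X t ≤ Bt * Real.exp (-δ₀ * distCT (domCount (F.P K) M (k + 1)) M (e t) (nearT (M := M) (e t) X)))
    (lo : (k K : ℕ) → (domSys (F.P K) M (k + 1)).Dom → Prop) [∀ k K, DecidablePred (lo k K)]
    (hlo : ∀ (k K : ℕ) (X : (domSys (F.P K) M (k + 1)).Dom), ¬ lo k K X →
      let e : Site (F.P K) (k + 1) → TPt 4 (domCount (F.P K) M (k + 1) * M) := fun x i => (ZMod.cast (x i) : ZMod (domCount (F.P K) M (k + 1) * M))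
      (K : ℝ) ≤ torusTreeLen X.1 ∨ (K : ℝ) ≤ distCT (domCount (F.P K) M (k + 1)) M (e (siteOfInt F K (k + 1) 0)) (nearT (M := M) (e (siteOfInt F K (k + 1) 0)) X))
    (hr₀ : r₀ < 1) (hr₀' : 0 ≤ r₀)
    (hS : letI := θW.instVβ₁; letI := θW.instVβ₂; letI := θW.instιβ
      ∀ g ∈ Window θW.γ, ∀ (k : ℕ) (μ ν : Fin 4) (z : Fin 4 → ℤ), ∃ (K₀ : ℕ) (C : ℝ), ∀ K : ℕ, K₀ ≤ K →
      |∑ X ∈ Finset.univ.filter (lo k (K + 1)), polScalar (fun U' => (((S (K + 1)) k).E (histPrefix g k) (emb (K + 1) k U') X).re) θW.ρ8 θW.bV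
            (Fin.cast (F.P_d (K + 1)).symm μ) (siteOfInt F (K + 1) (k + 1) z) (Fin.cast (F.P_d (K + 1)).symm ν) (siteOfInt F (K + 1) (k + 1) 0) -
        ∑ X ∈ Finset.univ.filter (lo k K), polScalar (fun U' => (((S K) k).E (histPrefix g k) (emb K k U') X).re) θW.ρ8 θW.bV
            (Fin.cast (F.P_d K).symm μ) (siteOfInt F K (k + 1) z) (Fin.cast (F.P_d K).symm ν) (siteOfInt F K (k + 1) 0)| ≤ C * r₀ ^ K) :
    ∃ β' : ℝ, BetaLowerH (-β') γ₀ (betaOfRecord₁₃ F 2 (theta13OfThm1CCM F 2 j ε₀ ε₂₉ B₃ B₃' a₀ a₁)) ∧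
      BetaUpperH β' γ₀ (betaOfRecord₁₃ F 2 (theta13OfThm1CCM F 2 j ε₀ ε₂₉ B₃ B₃' a₀ a₁)) := by
  obtain ⟨hlow, hup⟩ := absBox_betaOfRecord₁₃_of_activitySlots_of_approxStable F 2 θW m' M hM S emb hloc Wk hWk sp hκpos hA hr₁ hκ hκ4 hrate hsmall
    hδ₀ hBt hr h238 Ec ι Φ U hU hrU hHhol hΦemb hΦsp w hw₀ hw htail lo hlo hr₀ hr₀' hS
  subst hθ
  rw [theta13OfThm1CCMW_γ] at hlow hup
  exact ⟨_, betaLowerH_half_of_theta13OfThm1CCMW hγh hlow, betaUpperH_half_of_theta13OfThm1CCMW hγh hup⟩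

end ActivitySlotsAtWindowWitness

end Summit.QuantumFields.YangMills.Theorems.K0Stub3SocketWindowEdition

end
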